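import Literature.AnabelianGeometry.SemiGraphs.TemperedHbddOfLocallyFinite
import Literature.AnabelianGeometry.SemiGraphs.TemperedCompactInVerticialAtOfFixedSystems
import HarnessLib

/-!
# [SemiAnbd] Thm 3.7 (iii), SECOND AND THIRD SENTENCES, at every LOCALLY FINITE countable `𝒢` — no binder

Mochizuki, *Semi-graphs of anabelioids*, Publ. RIMS **42** (2006), §3, Theorem 3.7 (iii), manuscript
pp. 40–41: "If a nontrivial compact subgroup of `π₁^temp(𝒢)` is contained in more than one verticial
subgroup, then it is contained in precisely two verticial subgroups … In particular, in this case, this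
compact subgroup is contained in the image of some `π̂₁(𝒢_e)`, for some [closed] edge `e` of `𝔾`"
[cite: MochizukiSemiAnbd2006, Thm 3.7(iii) pp.40-41].

PROOF-ONLY (cell abc-iut, layer L3, GAP row G-t6g3-2b «no escape»; seat abc-iut-w6-d062, closing corollary of the
HBDD-LOCFIN programme HOME/staging/w6/w6-d062/HBDD-LOCFIN-memo.md).  The EXISTENCE sentence of Thm 3.7 (iii)
("every compact subgroup is contained in at least one verticial subgroup") fails at abc-iut-L3-d1's countermodel
`𝒢_θ` (FRONTIER programme REFUTE-F1732); the UNIQUENESS and EDGE sentences do NOT need it: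

* `compactInTwoVerticial_of_isLocallyFinite` — for every `𝒢` satisfying the hypotheses of Thm 3.7 with
  LOCALLY FINITE underlying semi-graph, EVERY chart `c`, every compact `C ≠ 1` contained in two distinct
  verticial subgroups `H₁`, `H₂`: every verticial subgroup containing `C` is `H₁` or `H₂`, and `C` lies in an
  edge-like subgroup of a CLOSED edge — i.e. the second conjunct of the per-graph form
  `CompactInVerticialAt 𝒢` of the frozen named fact F-1732, HYPOTHESIS-FREE beyond print's hypotheses and
  local finiteness (all dual graphs; `𝒢_θ`).  Assembly: abc-iut-w4-d080's
  `VerticialLevelData.conj2_of_fixedSystems` (its binder `hadj`) at the level data of `c` TRANSPORTED from the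
  canonical tower (abc-iut-w4-d083's `hadj_transport`, abc-iut-L3-t10's `VerticialLevelData.transport`), where
  `hadj` is abc-iut-L3-t10's `hadj_temperedPiChart_of_bounded_dist'` fed by this seat's
  `hbdd_temperedPiChart_of_isLocallyFinite` (`TemperedHbddOfLocallyFinite.lean`); Thm 3.7 (ii)
  `verticialDistinct_holds` by name.

Nothing here asserts the existence sentence for an infinite `𝔾`; nothing here bears on [IUTchIII] Cor. 3.12;
typed ≠ proved elsewhere.
-/

namespace Literature.AnabelianGeometry.SemiGraphs

namespace ProfiniteSemiGraph

open CategoryTheory Topology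

universe u

variable (𝒢 : ProfiniteSemiGraph.{u})

/-- **The adjacency clause `hadj` of (FIX∞) at the canonical tower, HYPOTHESIS-FREE at a locally finite `𝒢`**:
two compatible vertex systems fixed by a compact `C ≠ 1` are, at every level where they differ, the two ends of
a `C`-fixed edge (abc-iut-L3-t10's `hadj_temperedPiChart_of_bounded_dist'` with its bound `hbdd` supplied by
`hbdd_temperedPiChart_of_isLocallyFinite`). [cite: MochizukiSemiAnbd2006, Thm 3.7(iii) p.41] -/
theorem hadj_temperedPiChart_of_isLocallyFinite (h37 : 𝒢.Thm37Hypotheses) (hlf : 𝒢.graph.IsLocallyFinite)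
    (C : Subgroup (𝒢.temperedPiChart h37.toProp36Hypotheses).G)
    (hCc : IsCompact (C : Set (𝒢.temperedPiChart h37.toProp36Hypotheses).G)) (hC : C ≠ ⊥)
    (x x' : ∀ j, ((verticialLevelData_temperedPiChart (h36 := h37.toProp36Hypotheses)).tree j).Vertex)
    (hx : ∀ ⦃i j : ℕ⦄ (hij : i ≤ j), ((verticialLevelData_temperedPiChart (h36 := h37.toProp36Hypotheses)).trans hij).vertexMap (x j) = x i)
    (hx' : ∀ ⦃i j : ℕ⦄ (hij : i ≤ j), ((verticialLevelData_temperedPiChart (h36 := h37.toProp36Hypotheses)).trans hij).vertexMap (x' j) = x' i)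
    (hfx : ∀ g ∈ C, ∀ j, ((verticialLevelData_temperedPiChart (h36 := h37.toProp36Hypotheses)).act j g).hom.vertexMap (x j) = x j)
    (hfx' : ∀ g ∈ C, ∀ j, ((verticialLevelData_temperedPiChart (h36 := h37.toProp36Hypotheses)).act j g).hom.vertexMap (x' j) = x' j)
    (j : ℕ) (hne : x j ≠ x' j) :
    ∃ (e : ((verticialLevelData_temperedPiChart (h36 := h37.toProp36Hypotheses)).tree j).Edge)
      (b b' : ((verticialLevelData_temperedPiChart (h36 := h37.toProp36Hypotheses)).tree j).Branch), b ≠ b' ∧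
      ((verticialLevelData_temperedPiChart (h36 := h37.toProp36Hypotheses)).tree j).edgeOf b = e ∧
      ((verticialLevelData_temperedPiChart (h36 := h37.toProp36Hypotheses)).tree j).edgeOf b' = e ∧
      ((verticialLevelData_temperedPiChart (h36 := h37.toProp36Hypotheses)).tree j).abuts b = some (x j) ∧
      ((verticialLevelData_temperedPiChart (h36 := h37.toProp36Hypotheses)).tree j).abuts b' = some (x' j) ∧
      ∀ g ∈ C, ((verticialLevelData_temperedPiChart (h36 := h37.toProp36Hypotheses)).act j g).hom.edgeMap e = e :=
  hadj_temperedPiChart_of_bounded_dist' h37 C hCc hC x x' hx hx' hfx hfx'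
    (𝒢.hbdd_temperedPiChart_of_isLocallyFinite h37 hlf C hC x x' hx hx' hfx hfx') j hne

/-- **[SemiAnbd] Theorem 3.7 (iii), second and third sentences, at every locally finite countable `𝒢` and every
chart** — "if a nontrivial compact subgroup of `π₁^temp(𝒢)` is contained in more than one verticial subgroup,
then it is contained in precisely two verticial subgroups … [and] in the image of some `π̂₁(𝒢_e)`" (`e` a closed
edge): the second conjunct of `CompactInVerticialAt 𝒢`, with NO hypothesis beyond those of Thm 3.7 and local
finiteness of `𝔾`. [cite: MochizukiSemiAnbd2006, Thm 3.7(iii) pp.40-41] -/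
theorem compactInTwoVerticial_of_isLocallyFinite (h37 : 𝒢.Thm37Hypotheses) (hlf : 𝒢.graph.IsLocallyFinite) (c : TemperedPiChart 𝒢)
    (C : Subgroup c.G) (hCc : IsCompact (C : Set c.G)) (hC : C ≠ ⊥)
    {v₁ v₂ : 𝒢.graph.Vertex} {H₁ H₂ : Subgroup c.G} (hH₁ : H₁ ∈ verticialSubgroups c v₁)
    (hH₂ : H₂ ∈ verticialSubgroups c v₂) (hne : H₁ ≠ H₂) (hC₁ : C ≤ H₁) (hC₂ : C ≤ H₂) :
    (∀ (v₃ : 𝒢.graph.Vertex) (H₃ : Subgroup c.G), H₃ ∈ verticialSubgroups c v₃ → C ≤ H₃ →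
        H₃ = H₁ ∨ H₃ = H₂) ∧
      ∃ (e : 𝒢.graph.Edge) (L : Subgroup c.G), 𝒢.graph.IsClosedEdge e ∧
        L ∈ edgeLikeSubgroups c e ∧ C ≤ L := by
  obtain ⟨φ, ψ, hψφ, hφψ, hφ, hψ⟩ :=
    TemperedPiChart.exists_compatIso (𝒢.temperedPiChart h37.toProp36Hypotheses) c
  let D₀ := verticialLevelData_temperedPiChart (h36 := h37.toProp36Hypotheses)
  let D : VerticialLevelData.{0} 𝒢 c := D₀.transport φ ψ hψφ hφψ
    (fun v H => mem_verticialSubgroups_iff_map φ hφ ψ hφψ hψ H)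
    (fun e L => mem_edgeLikeSubgroups_iff_map φ hφ ψ hφψ hψ L)
  exact D.conj2_of_fixedSystems verticialDistinct_holds h37 C
    (D₀.hadj_transport φ ψ hψφ hφψ _ _
      (fun C' hC'c hC' x x' hx hx' hfx hfx' j hne' =>
        𝒢.hadj_temperedPiChart_of_isLocallyFinite h37 hlf C' hC'c hC' x x' hx hx' hfx hfx' j hne') C hCc hC)
    hH₁ hH₂ hne hC₁ hC₂

/-- **At a locally finite countable `𝒢`, Thm 3.7 (iii) at `𝒢` is EQUIVALENT to its EXISTENCE sentence**:
`CompactInVerticialAt 𝒢` holds iff (under the hypotheses of Thm 3.7) every compact subgroup of every chart lies in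
some verticial subgroup — the uniqueness / edge conjunct being the theorem
`compactInTwoVerticial_of_isLocallyFinite`.  So at locally finite `𝔾` the frontier row G-t6g3-2b IS the
existence sentence ("every compact subgroup … is contained in at least one verticial subgroup", p. 40), and any
refutation of `CompactInVerticialAt 𝒢` there refutes existence. [cite: MochizukiSemiAnbd2006, Thm 3.7(iii) pp.40-41] -/
theorem compactInVerticialAt_iff_exists_verticial_of_isLocallyFinite (hlf : 𝒢.graph.IsLocallyFinite) :
    CompactInVerticialAt 𝒢 ↔
      (𝒢.Thm37Hypotheses → ∀ (c : TemperedPiChart 𝒢) (C : Subgroup c.G), IsCompact (C : Set c.G) →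
        ∃ (v : 𝒢.graph.Vertex) (H : Subgroup c.G), H ∈ verticialSubgroups c v ∧ C ≤ H) :=
  ⟨fun h h37 c C hCc => (h h37 c C hCc).1,
    fun h h37 c C hCc => ⟨h h37 c C hCc, fun hC _ _ _ _ hH₁ hH₂ hne hC₁ hC₂ =>
      𝒢.compactInTwoVerticial_of_isLocallyFinite h37 hlf c C hCc hC hH₁ hH₂ hne hC₁ hC₂⟩⟩

/-- **Negative reading at a locally finite countable `𝒢`**: if `CompactInVerticialAt 𝒢` fails (which forces the
hypotheses of Thm 3.7, the statement being vacuous otherwise), then some chart carries a compact subgroup contained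
in NO verticial subgroup (the witness behind any refutation is an «escaping» compact subgroup, as at
abc-iut-L3-d1's `𝒢_θ`).
[cite: MochizukiSemiAnbd2006, Thm 3.7(iii) pp.40-41] -/
theorem exists_compact_forall_not_le_verticial_of_isLocallyFinite
    (hlf : 𝒢.graph.IsLocallyFinite) (hnot : ¬ CompactInVerticialAt 𝒢) :
    ∃ (c : TemperedPiChart 𝒢) (C : Subgroup c.G), IsCompact (C : Set c.G) ∧
      ∀ (v : 𝒢.graph.Vertex) (H : Subgroup c.G), H ∈ verticialSubgroups c v → ¬ C ≤ H := by
  by_contra hcon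
  refine hnot ((𝒢.compactInVerticialAt_iff_exists_verticial_of_isLocallyFinite hlf).mpr fun _ c C hCc => ?_)
  by_contra hex
  exact hcon ⟨c, C, hCc, fun v H hH hCH => hex ⟨v, H, hH, hCH⟩⟩

end ProfiniteSemiGraph

end Literature.AnabelianGeometry.SemiGraphs
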